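import Literature.NumberTheory.ComplexMultiplication.CMTypeRankIrreducibleSlot
import HarnessLib

/-!
# A sextic slot against an octic slot, I: an automorphism of order three and the frames it cuts out

COR-CM (cell `pub-hodgecm2`, binder seat `b16` gen 47, count-neutral claim CM34-COMPLETE, file F1; theorems only, no
definition, no named fact, no `sorry`).  Abstract setting of `Literature/NumberTheory/ComplexMultiplication/CMTypeRank`:
a group `G` acts on two finite sets `X` (`|X| = 6`, in print `Hom(K_T, ℂ)` for a SEXTIC CM field — a simple CM abelian
threefold `T`) and `Y` (`|Y| = 8`, `Hom(K_F, ℂ)` for an OCTIC CM field — a CM abelian fourfold `F`), with a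
"complex conjugation" `ρ ∈ G` acting on both as a fixed-point-free involution commuting with `G` (`IsCMTypeWith ρ _`).
This file supplies the combinatorial skeleton of the (3,4) cell (`SexticOcticSlotCommonConstituent`):

* §1 **`exists_cube_eq_one`** — if `G` is transitive on `X`, some `g ∈ G` acts with `g³ = 1` on `X ⊔ Y` and
  non-trivially on `X ⊔ Y` (orbit–stabiliser gives `6 ∣ |image of G in Sym X × Sym Y|`, then Cauchy for `p = 3`);
* §2 **the `X`-frame of an element `c` with `c³ = 1` moving `x₀ ∈ X`**: the six points
  `x₀, cx₀, c²x₀, ρx₀, ρcx₀, ρc²x₀` are pairwise distinct and exhaust `X` (`frameX_cases`), i.e. `c` CYCLES THE THREE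
  PAIRS of `X`; the set `{x₀, cx₀, c²x₀}` is a CM type for `ρ` (`isCMTypeWith_orbitType`), fixed by `c`;
* §3 **the `Y`-frame of `c` with `c³ = 1`, a fixed point `y₀` and a moved point `y₁`**: the eight points
  `y₀, ρy₀, cʲy₁, ρcʲy₁` are pairwise distinct and exhaust `Y` (`frameY_cases`) — `c` fixes one pair and cycles the
  other three; a fixed point always exists (`exists_smul_eq_self_of_cube`, `8 ≢ 0 (mod 3)`).

Everything is elementary (finite group actions); used with `G = Aut(ℂ)`.

## References

* [Dodson1984] B. Dodson, *The structure of Galois groups of CM-fields*, Trans. AMS 283 (1984), §5.1.1–§5.1.2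
  (imprimitive Galois groups `(ℤ/2)^v ⋊ H` of CM fields of degree `6` and `8`).
* [Yanai1985] H. Yanai, *On the rank of CM-type*, Nagoya Math. J. 97 (1985), §3 (Cauchy's theorem in the image of the
  Galois group on the embeddings).

Provenance: Literature home (family `hodge`, namespace `Literature.NumberTheory.ComplexMultiplication.SexticOctic`) of the Summits-side `CorCM/SexticOcticSlotOrderThree` (cell `pub-hodgecm2`, COR-CM; all its imports are `Literature/` and Mathlib), which `Literature/` may not import; theorems only, no named fact, no definition. Nothing here bears on `HC_CM`. Lane `lit-hodgefound` (Layer A3: CM types, their Kubota ranks and Galois combinatorics), seat p20.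
-/

noncomputable section

namespace Literature.NumberTheory.ComplexMultiplication.SexticOctic

open Literature.NumberTheory.ComplexMultiplication

variable {G : Type*} [Group G]

/-! ## §1 An element of order three -/

section Cauchy

variable {X Y : Type*} [MulAction G X] [MulAction G Y] [Fintype X] [Fintype Y]

/-- **An automorphism of order `3` on the embeddings of a sextic field and of a second field.**  If `G` acts
transitively on `X` with `|X| = 6`, then some `g ∈ G` satisfies `g³ = 1` on `X` and on `Y` and moves a point of `X` or
of `Y`: `6` divides the order of the image of `G` in `Sym(X) × Sym(Y)` (orbit–stabiliser), and Cauchy's theorem gives an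
element of order `3` there. [cite: Yanai1985, §3 (p. 170)] -/
theorem exists_cube_eq_one [MulAction.IsPretransitive G X] (hX : Fintype.card X = 6) :
    ∃ g : G, (∀ x : X, g • g • g • x = x) ∧ (∀ y : Y, g • g • g • y = y) ∧
      ((∃ x : X, g • x ≠ x) ∨ ∃ y : Y, g • y ≠ y) := by
  classical
  haveI : Fact (Nat.Prime 3) := ⟨Nat.prime_three⟩
  obtain ⟨x₀⟩ : Nonempty X := by rw [← Fintype.card_pos_iff, hX]; norm_num
  let θ : G →* Equiv.Perm X × Equiv.Perm Y := (MulAction.toPermHom G X).prod (MulAction.toPermHom G Y)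
  have hθ1 : ∀ (g : G) (x : X), (θ g).1 x = g • x := fun g x => rfl
  have hθ2 : ∀ (g : G) (y : Y), (θ g).2 y = g • y := fun g y => rfl
  -- adapted from `CorCM/FixingCycleSlotPairs` §3: the image acts transitively on `X` through the first projection
  letI : MulAction θ.range X :=
    MulAction.compHom X ((MonoidHom.fst (Equiv.Perm X) (Equiv.Perm Y)).comp θ.range.subtype)
  have hsmul : ∀ (r : θ.range) (x : X), r • x = (r : Equiv.Perm X × Equiv.Perm Y).1 x := fun _ _ => rfl
  haveI : MulAction.IsPretransitive θ.range X := ⟨fun x y => by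
    obtain ⟨g, hg⟩ := MulAction.exists_smul_eq G x y
    exact ⟨⟨θ g, g, rfl⟩, by rw [hsmul]; exact hg⟩⟩
  have hdvd : 3 ∣ Nat.card θ.range := by
    have h1 := (MulAction.stabilizer θ.range x₀).index_mul_card
    rw [MulAction.index_stabilizer_of_transitive, Nat.card_eq_fintype_card, hX] at h1
    exact Dvd.intro (2 * Nat.card (MulAction.stabilizer θ.range x₀)) (by rw [← h1]; ring)
  obtain ⟨σ, hσ⟩ := exists_prime_orderOf_dvd_card' 3 hdvd
  obtain ⟨g, hg⟩ := MonoidHom.mem_range.1 σ.2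
  have hord : orderOf (θ g) = 3 := by rw [hg, Subgroup.orderOf_coe, hσ]
  have hpow : θ (g ^ 3) = 1 := by rw [map_pow, ← hord, pow_orderOf_eq_one]
  have hg3 : g ^ 3 = g * g * g := by rw [pow_succ, pow_two]
  refine ⟨g, fun x => ?_, fun y => ?_, ?_⟩
  · have h := hθ1 (g ^ 3) x
    rw [hpow, hg3, mul_smul, mul_smul] at h
    exact h.symm
  · have h := hθ2 (g ^ 3) y
    rw [hpow, hg3, mul_smul, mul_smul] at h
    exact h.symm
  · by_contra hall
    push Not at hall
    have h1 : θ g = 1 := by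
      refine Prod.ext (Equiv.ext fun x => ?_) (Equiv.ext fun y => ?_)
      · rw [hθ1]; exact hall.1 x
      · rw [hθ2]; exact hall.2 y
    rw [h1, orderOf_one] at hord
    exact absurd hord (by norm_num)

end Cauchy

/-! ## §2 The frame of an element of order three on six points: it cycles the three pairs -/

section FrameX

variable {X : Type*} [MulAction G X] {ρ : G} {Φ : Set X}

/-- **The cross relations of the frame.**  For `c` with `c³ = 1` moving `x₀` (and `ρ` a commuting fixed-point-free
involution): `cx₀ ≠ x₀`, `c²x₀ ≠ x₀`, `c²x₀ ≠ cx₀`, and no point of `{x₀, cx₀, c²x₀}` is conjugate to another —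
`x₀, cx₀, c²x₀` lie in three different conjugate pairs. [cite: Dodson1984, §5.1.1] -/
theorem frameX_ne (hΦ : IsCMTypeWith ρ Φ) {c : G} (hc3 : ∀ x : X, c • c • c • x = x) {x₀ : X}
    (hx₀ : c • x₀ ≠ x₀) :
    c • c • x₀ ≠ x₀ ∧ c • c • x₀ ≠ c • x₀ ∧ c • x₀ ≠ ρ • x₀ ∧ c • c • x₀ ≠ ρ • x₀ ∧ c • c • x₀ ≠ ρ • c • x₀ ∧
      x₀ ≠ ρ • c • x₀ ∧ x₀ ≠ ρ • c • c • x₀ ∧ c • x₀ ≠ ρ • c • c • x₀ := by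
  have h2 : c • c • x₀ ≠ x₀ := fun h => hx₀ (by have := hc3 x₀; rwa [h] at this)
  have h3 : c • c • x₀ ≠ c • x₀ := fun h => hx₀ (smul_left_cancel c h)
  have h4 : c • x₀ ≠ ρ • x₀ := by
    intro h
    apply h2
    rw [h, hΦ.comm, h, hΦ.invol]
  have h6 : c • c • x₀ ≠ ρ • x₀ := by
    intro h
    have e : ρ • c • x₀ = x₀ := by
      have := hc3 x₀
      rw [h, hΦ.comm] at this
      exact this
    apply h4
    have := congrArg (ρ • ·) e
    simpa only [hΦ.invol] using this
  have h5 : c • c • x₀ ≠ ρ • c • x₀ := by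
    rw [← hΦ.comm c x₀]
    exact fun h => h4 (smul_left_cancel c h)
  have h7 : x₀ ≠ ρ • c • x₀ := by
    intro h
    apply h4
    have := congrArg (ρ • ·) h
    simp only [hΦ.invol] at this
    exact this.symm
  have h8 : x₀ ≠ ρ • c • c • x₀ := by
    intro h
    apply h6
    have := congrArg (ρ • ·) h
    simp only [hΦ.invol] at this
    exact this.symm
  have h9 : c • x₀ ≠ ρ • c • c • x₀ := by
    rw [← hΦ.comm c (c • x₀)]
    exact fun h => h7 (smul_left_cancel c h)
  exact ⟨h2, h3, h4, h6, h5, h7, h8, h9⟩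

variable [Fintype X] [DecidableEq X]

/-- **The frame exhausts `X`** (`|X| = 6`): every point is one of `x₀, cx₀, c²x₀, ρx₀, ρcx₀, ρc²x₀` — `c` cycles the
three conjugate pairs. [cite: Dodson1984, §5.1.2] -/
theorem frameX_cases (hΦ : IsCMTypeWith ρ Φ) (hX : Fintype.card X = 6) {c : G}
    (hc3 : ∀ x : X, c • c • c • x = x) {x₀ : X} (hx₀ : c • x₀ ≠ x₀) (x : X) :
    x = x₀ ∨ x = c • x₀ ∨ x = c • c • x₀ ∨ x = ρ • x₀ ∨ x = ρ • c • x₀ ∨ x = ρ • c • c • x₀ := by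
  obtain ⟨h2, h3, h4, h6, h5, h7, h8, h9⟩ := frameX_ne hΦ hc3 hx₀
  have hρ : ∀ z : X, ρ • z ≠ z := hΦ.rho_smul_ne
  have hS : ({x₀, c • x₀, c • c • x₀, ρ • x₀, ρ • c • x₀, ρ • c • c • x₀} : Finset X) = Finset.univ := by
    apply Finset.eq_univ_of_card
    rw [hX, Finset.card_insert_of_notMem, Finset.card_insert_of_notMem, Finset.card_insert_of_notMem,
      Finset.card_insert_of_notMem, Finset.card_insert_of_notMem, Finset.card_singleton]
    · simp only [Finset.mem_singleton]
      exact fun h => h3.symm (smul_left_cancel ρ h)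
    · simp only [Finset.mem_insert, Finset.mem_singleton, not_or]
      exact ⟨fun h => hx₀.symm (smul_left_cancel ρ h), fun h => h2.symm (smul_left_cancel ρ h)⟩
    · simp only [Finset.mem_insert, Finset.mem_singleton, not_or]
      exact ⟨h6, h5, (hρ _).symm⟩
    · simp only [Finset.mem_insert, Finset.mem_singleton, not_or]
      exact ⟨h3.symm, h4, (hρ _).symm, h9⟩
    · simp only [Finset.mem_insert, Finset.mem_singleton, not_or]
      exact ⟨hx₀.symm, h2.symm, (hρ _).symm, h7, h8⟩
  have hx : x ∈ ({x₀, c • x₀, c • c • x₀, ρ • x₀, ρ • c • x₀, ρ • c • c • x₀} : Finset X) := by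
    rw [hS]; exact Finset.mem_univ x
  simpa only [Finset.mem_insert, Finset.mem_singleton] using hx

omit [Fintype X] [DecidableEq X] in
/-- **The orbit type `Φ₊ = {x₀, cx₀, c²x₀}` is a CM type for `ρ`** (one point from each conjugate pair), given that the
frame exhausts `X`. [cite: Dodson1984, §5.1.2] -/
theorem isCMTypeWith_orbitType (hΦ : IsCMTypeWith ρ Φ) {c : G} (hc3 : ∀ x : X, c • c • c • x = x) {x₀ : X}
    (hx₀ : c • x₀ ≠ x₀)
    (hcases : ∀ x : X, x = x₀ ∨ x = c • x₀ ∨ x = c • c • x₀ ∨ x = ρ • x₀ ∨ x = ρ • c • x₀ ∨ x = ρ • c • c • x₀) :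
    IsCMTypeWith ρ ({x₀, c • x₀, c • c • x₀} : Set X) where
  mem_iff x := by
    obtain ⟨h2, h3, h4, h6, h5, h7, h8, h9⟩ := frameX_ne hΦ hc3 hx₀
    have hρ : ∀ z : X, ρ • z ≠ z := hΦ.rho_smul_ne
    simp only [Set.mem_insert_iff, Set.mem_singleton_iff]
    rcases hcases x with rfl | rfl | rfl | rfl | rfl | rfl
    · simp only [true_or, true_iff, not_or]
      exact ⟨hρ _, fun h => h4 h.symm, fun h => h6 h.symm⟩
    · simp only [true_or, or_true, true_iff, not_or]
      exact ⟨fun h => h7 h.symm, hρ _, fun h => h5 h.symm⟩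
    · simp only [or_true, true_iff, not_or]
      exact ⟨fun h => h8 h.symm, fun h => h9 h.symm, hρ _⟩
    · simp only [hΦ.invol, true_or, not_true_eq_false, iff_false, not_or]
      exact ⟨(hρ _), fun h => h7 (by have := congrArg (ρ • ·) h; simpa only [hΦ.invol] using this),
        fun h => h8 (by have := congrArg (ρ • ·) h; simpa only [hΦ.invol] using this)⟩
    · simp only [hΦ.invol, true_or, or_true, not_true_eq_false, iff_false, not_or]
      exact ⟨fun h => h4 (by have := congrArg (ρ • ·) h; simpa only [hΦ.invol] using this), hρ _,
        fun h => h9 (by have := congrArg (ρ • ·) h; simpa only [hΦ.invol] using this)⟩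
    · simp only [hΦ.invol, or_true, not_true_eq_false, iff_false, not_or]
      exact ⟨fun h => h6 (by have := congrArg (ρ • ·) h; simpa only [hΦ.invol] using this),
        fun h => h5 (by have := congrArg (ρ • ·) h; simpa only [hΦ.invol] using this), hρ _⟩
  comm := hΦ.comm
  invol := hΦ.invol

omit [Fintype X] [DecidableEq X] in
/-- `c` fixes the orbit type: `cx ∈ Φ₊ ↔ x ∈ Φ₊`. [cite: Dodson1984, §5.1.2] -/
theorem smul_mem_orbitType_iff {c : G} (hc3 : ∀ x : X, c • c • c • x = x) (x₀ x : X) :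
    c • x ∈ ({x₀, c • x₀, c • c • x₀} : Set X) ↔ x ∈ ({x₀, c • x₀, c • c • x₀} : Set X) := by
  simp only [Set.mem_insert_iff, Set.mem_singleton_iff]
  constructor
  · rintro (h | h | h)
    · right; right
      have := hc3 x
      rw [h] at this
      exact this.symm
    · left; exact smul_left_cancel c h
    · right; left; exact smul_left_cancel c h
  · rintro (rfl | rfl | rfl)
    · right; left; rfl
    · right; right; rfl
    · left; exact hc3 x₀

end FrameX

/-! ## §3 The frame of an element of order three on eight points with a fixed point: one fixed pair, three cycled -/

section FrameY

variable {Y : Type*} [MulAction G Y] {ρ : G} {Ψ : Set Y}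

/-- A fixed point of `c` and its conjugate are not in the frame of a moved point: `y₀, ρy₀ ∉ {cʲy₁, ρcʲy₁}`. [cite: Dodson1984, §5.1.2] -/
theorem fixed_ne_frame (hΨ : IsCMTypeWith ρ Ψ) {c : G} (hc3 : ∀ y : Y, c • c • c • y = y) {y₀ y₁ : Y}
    (hy₀ : c • y₀ = y₀) (hy₁ : c • y₁ ≠ y₁) :
    (y₀ ≠ y₁ ∧ y₀ ≠ c • y₁ ∧ y₀ ≠ c • c • y₁ ∧ y₀ ≠ ρ • y₁ ∧ y₀ ≠ ρ • c • y₁ ∧ y₀ ≠ ρ • c • c • y₁) ∧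
      (ρ • y₀ ≠ y₁ ∧ ρ • y₀ ≠ c • y₁ ∧ ρ • y₀ ≠ c • c • y₁ ∧ ρ • y₀ ≠ ρ • y₁ ∧ ρ • y₀ ≠ ρ • c • y₁ ∧
        ρ • y₀ ≠ ρ • c • c • y₁) := by
  -- every point of the frame of `y₁` is moved by `c`; `y₀` and `ρ y₀` are fixed
  have hmoved : ∀ z : Y, (z = y₁ ∨ z = c • y₁ ∨ z = c • c • y₁ ∨ z = ρ • y₁ ∨ z = ρ • c • y₁ ∨
      z = ρ • c • c • y₁) → c • z ≠ z := by
    have hcc : c • c • y₁ ≠ y₁ := fun h => hy₁ (by have := hc3 y₁; rwa [h] at this)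
    rintro z (rfl | rfl | rfl | rfl | rfl | rfl) h
    · exact hy₁ h
    · exact hy₁ (smul_left_cancel c h)
    · rw [hc3] at h; exact hcc h.symm
    · rw [hΨ.comm] at h; exact hy₁ (smul_left_cancel ρ h)
    · rw [hΨ.comm] at h; exact hy₁ (smul_left_cancel c (smul_left_cancel ρ h))
    · rw [hΨ.comm, hc3] at h; exact hcc (smul_left_cancel ρ h).symm
  have hρfix : c • ρ • y₀ = ρ • y₀ := by rw [hΨ.comm, hy₀]
  refine ⟨⟨?_, ?_, ?_, ?_, ?_, ?_⟩, ?_, ?_, ?_, ?_, ?_, ?_⟩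
  · intro h; exact hmoved _ (Or.inl h) hy₀
  · intro h; exact hmoved _ (Or.inr (Or.inl h)) hy₀
  · intro h; exact hmoved _ (Or.inr (Or.inr (Or.inl h))) hy₀
  · intro h; exact hmoved _ (Or.inr (Or.inr (Or.inr (Or.inl h)))) hy₀
  · intro h; exact hmoved _ (Or.inr (Or.inr (Or.inr (Or.inr (Or.inl h))))) hy₀
  · intro h; exact hmoved _ (Or.inr (Or.inr (Or.inr (Or.inr (Or.inr h))))) hy₀
  · intro h; exact hmoved _ (Or.inl h) hρfix
  · intro h; exact hmoved _ (Or.inr (Or.inl h)) hρfix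
  · intro h; exact hmoved _ (Or.inr (Or.inr (Or.inl h))) hρfix
  · intro h; exact hmoved _ (Or.inr (Or.inr (Or.inr (Or.inl h)))) hρfix
  · intro h; exact hmoved _ (Or.inr (Or.inr (Or.inr (Or.inr (Or.inl h))))) hρfix
  · intro h; exact hmoved _ (Or.inr (Or.inr (Or.inr (Or.inr (Or.inr h))))) hρfix

variable [Fintype Y] [DecidableEq Y]

/-- **The `Y`-frame exhausts `Y`** (`|Y| = 8`): for `c` with `c³ = 1`, a fixed point `y₀` and a moved point `y₁`, every
point is one of `y₀, ρy₀, y₁, cy₁, c²y₁, ρy₁, ρcy₁, ρc²y₁` — `c` fixes the pair `{y₀, ρy₀}` pointwise and cycles the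
three other pairs. [cite: Dodson1984, §5.1.1] -/
theorem frameY_cases (hΨ : IsCMTypeWith ρ Ψ) (hY : Fintype.card Y = 8) {c : G}
    (hc3 : ∀ y : Y, c • c • c • y = y) {y₀ y₁ : Y} (hy₀ : c • y₀ = y₀) (hy₁ : c • y₁ ≠ y₁) (y : Y) :
    y = y₀ ∨ y = ρ • y₀ ∨ y = y₁ ∨ y = c • y₁ ∨ y = c • c • y₁ ∨
      y = ρ • y₁ ∨ y = ρ • c • y₁ ∨ y = ρ • c • c • y₁ := by
  obtain ⟨h2, h3, h4, h6, h5, h7, h8, h9⟩ := frameX_ne hΨ hc3 hy₁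
  obtain ⟨⟨n1, n2, n3, n4, n5, n6⟩, m1, m2, m3, m4, m5, m6⟩ := fixed_ne_frame hΨ hc3 hy₀ hy₁
  have hρ : ∀ z : Y, ρ • z ≠ z := hΨ.rho_smul_ne
  have hS : ({y₀, ρ • y₀, y₁, c • y₁, c • c • y₁, ρ • y₁, ρ • c • y₁, ρ • c • c • y₁} : Finset Y) =
      Finset.univ := by
    apply Finset.eq_univ_of_card
    rw [hY, Finset.card_insert_of_notMem, Finset.card_insert_of_notMem, Finset.card_insert_of_notMem,
      Finset.card_insert_of_notMem, Finset.card_insert_of_notMem, Finset.card_insert_of_notMem,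
      Finset.card_insert_of_notMem, Finset.card_singleton]
    · simp only [Finset.mem_singleton]
      exact fun h => h3.symm (smul_left_cancel ρ h)
    · simp only [Finset.mem_insert, Finset.mem_singleton, not_or]
      exact ⟨fun h => hy₁.symm (smul_left_cancel ρ h), fun h => h2.symm (smul_left_cancel ρ h)⟩
    · simp only [Finset.mem_insert, Finset.mem_singleton, not_or]
      exact ⟨h6, h5, (hρ _).symm⟩
    · simp only [Finset.mem_insert, Finset.mem_singleton, not_or]
      exact ⟨h3.symm, h4, (hρ _).symm, h9⟩
    · simp only [Finset.mem_insert, Finset.mem_singleton, not_or]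
      exact ⟨hy₁.symm, h2.symm, (hρ _).symm, h7, h8⟩
    · simp only [Finset.mem_insert, Finset.mem_singleton, not_or]
      exact ⟨m1, m2, m3, m4, m5, m6⟩
    · simp only [Finset.mem_insert, Finset.mem_singleton, not_or]
      exact ⟨(hρ _).symm, n1, n2, n3, n4, n5, n6⟩
  have hy : y ∈ ({y₀, ρ • y₀, y₁, c • y₁, c • c • y₁, ρ • y₁, ρ • c • y₁, ρ • c • c • y₁} : Finset Y) := by
    rw [hS]; exact Finset.mem_univ y
  simpa only [Finset.mem_insert, Finset.mem_singleton] using hy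

omit [DecidableEq Y] in
/-- **An element with `c³ = 1` on eight points has a fixed point** (`8 ≢ 0 (mod 3)`; Mathlib
`Equiv.Perm.exists_fixed_point_of_prime`). [cite: Dodson1984, §5.1.2] -/
theorem exists_smul_eq_self_of_cube (hY : Fintype.card Y = 8) {c : G} (hc3 : ∀ y : Y, c • c • c • y = y) :
    ∃ y₀ : Y, c • y₀ = y₀ := by
  classical
  haveI : Fact (Nat.Prime 3) := ⟨Nat.prime_three⟩
  have h3 : (MulAction.toPerm c : Equiv.Perm Y) ^ 3 ^ 1 = 1 := by
    rw [pow_one]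
    ext y
    rw [show (3 : ℕ) = 1 + 1 + 1 from rfl, pow_succ, pow_succ, pow_one, Equiv.Perm.mul_apply,
      Equiv.Perm.mul_apply, MulAction.toPerm_apply, MulAction.toPerm_apply, MulAction.toPerm_apply,
      Equiv.Perm.one_apply]
    exact hc3 y
  obtain ⟨y₀, hy₀⟩ := Equiv.Perm.exists_fixed_point_of_prime (p := 3) (n := 1)
    (by rw [hY]; norm_num) h3
  exact ⟨y₀, by simpa only [MulAction.toPerm_apply] using hy₀⟩

end FrameY

end Literature.NumberTheory.ComplexMultiplication.SexticOctic

end
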